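import Literature.MathematicalPhysics.QuantumManyBody.PeriodicConfigFourier
import HarnessLib

/-!
# Translating the fundamental cell `[0,L)³`, and the condensate occupation of a positive state

Topic `Literature/MathematicalPhysics/QuantumManyBody`, namespace `BoseGas`. Two pieces of torus
bookkeeping for periodic `N`-body states (`PeriodicBoseGas.lean`):

**(1) Cell shifts**, the one-particle companion of the `N`-particle cell-shift lemmas
(`lintegral_cellN_comp_add` of `PeriodicBoseGasEq317.lean`, `setIntegral_cellN_comp_add` of
`PeriodicHeatFlowSpectralProofs.lean`), proved through the covering map `x ↦ x/L mod ℤ³` of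
`PeriodicBoseGasFourier.lean` (`toUnitTorus`, `fromUnitTorus`, `lintegral_fromUnitTorus`) and
translation invariance of the Haar measure of `(ℝ/ℤ)³`:

* `toUnitTorus_add`, `exists_fromUnitTorus_add_toUnitTorus` — the covering map is additive and
  the scaled representative of a translate is the translated representative up to `Lℤ³`;
* `setLIntegral_cell_comp_add_of_periodic`, `setIntegral_cell_comp_add_of_periodic` —
  **`∫_{[0,L)³} H(x + a) dx = ∫_{[0,L)³} H`** for `Lℤ³`-periodic `H` (`ℝ≥0∞` and Bochner);
* `exists_latticeVec_near`, `norm_sq_lt_of_coord` — torus coordinates of norm `< η`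
  (`‖x mod 1‖ = |x - round x|`) put `x` within `ηL` of a lattice point in every coordinate, hence
  within Euclidean distance `√3 ηL`;
* `periodic_lower_bound_near_lattice` — a bound `g(y) ≥ 1 - τ‖y‖²` valid on `ℝ³` transports,
  for `Lℤ³`-periodic `g`, to `g(x) ≥ 1 - 3τ(ηL)²` at every `x` whose torus coordinates are
  `η`-close to `0`.

**(2) The condensate occupation through the coherence** (step (i) of the infrared chain for BEC
of [Stringari1995, §2]): for a REAL NON-NEGATIVE periodic state `Ψ` of `n+1` bosons,
`⟨Ψ, n₀Ψ⟩ = N L⁻³ ∫_{cell^{n}} |∫_cell Ψ(x,Y) dx|² dY` (`condensateOccupation_succ` of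
`PeriodicBoseGasThm31.lean`) equals `N L⁻³ ∫_cell g(r) dr` with the translation-averaged coherence
`g(r) = ∫_cell dx ∫_{cell^n} dY Ψ(x+r,Y)Ψ(x,Y)` — expand the square and substitute `x' = x + r`
on the torus (`condensateOccupation_eq_lintegral_coherence`, Tonelli + the cell shift of (1)).

Local Haar `volume` convention on `ℝ/ℤ` of `PeriodicConfigFourier.lean` (re-activated, nothing
declared).

## References

* G. B. Folland, *A Course in Abstract Harmonic Analysis*, CRC Press 1995, §2.2 (invariance of Haar
  measure; integration over a quotient by a lattice).
* E. H. Lieb, R. Seiringer, J. P. Solovej, J. Yngvason, *The Mathematics of the Bose Gas and its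
  Condensation*, Birkhäuser 2005, Ch. 2 (the periodic box), §1.2 (1.17) (one-body density matrix
  and `n₀`). [`LSSY2005`]
* S. Stringari, *Bose–Einstein condensation and superfluidity in trapped atomic gases / sum rules*,
  in Bose–Einstein Condensation (Griffin, Snoke, Stringari eds.), CUP 1995, §2 (`n₀` from the
  long-range behaviour of the one-body density matrix). [`Stringari1995`]
* S. Fournais, *Length scales for BEC in the dilute Bose gas*, arXiv:2011.00309, (1.3)–(1.5).
  [`Fournais2020`]
-/

noncomputable section

open MeasureTheory Filter Set WithLp Complex
open scoped ENNReal NNReal ComplexConjugate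

namespace Literature.MathematicalPhysics.QuantumManyBody.BoseGas

-- The measure on `ℝ/ℤ` is the Haar probability measure: the LOCAL instances of
-- `PeriodicConfigFourier.lean` (definitionally those of `PeriodicBoseGasFourier.lean`), re-activated.
attribute [local instance] configFourier_measureSpace configFourier_isProbabilityMeasure
  configFourier_isProbabilityMeasure_pi configFourier_isAddLeftInvariant
  configFourier_isAddLeftInvariant_pi

/-! ### The covering map and translations -/

/-- `x ↦ x/L mod ℤ³` is additive. [folklore] -/
theorem toUnitTorus_add (L : ℝ) (x y : Space) :
    toUnitTorus L (x + y) = toUnitTorus L x + toUnitTorus L y := by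
  funext k
  simp only [toUnitTorus, Pi.add_apply, PiLp.add_apply, add_div, AddCircle.coe_add]

/-- The scaled representative of a translate differs from the translated representative by a
lattice vector. [folklore] -/
theorem exists_fromUnitTorus_add_toUnitTorus {L : ℝ} (hL : 0 < L) (t : UnitAddTorus (Fin 3))
    (a : Space) : ∃ m : Fin 3 → ℤ,
      fromUnitTorus L (t + toUnitTorus L a) = fromUnitTorus L t + a + latticeVec L m := by
  obtain ⟨m, hm⟩ := exists_fromUnitTorus_toUnitTorus_eq hL (fromUnitTorus L t + a)
  refine ⟨m, ?_⟩
  rw [← hm, toUnitTorus_add, toUnitTorus_fromUnitTorus hL.ne']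

/-! ### Shift invariance of cell integrals of periodic functions -/

/-- **Shift invariance of cell integrals of periodic functions** (`ℝ≥0∞` version): for `H`
`Lℤ³`-periodic along the axes, `∫_{[0,L)³} H(x + a) dx = ∫_{[0,L)³} H(x) dx` (both sides are `L³`
times the integral over the torus, where the shift is a Haar-measure-preserving translation).
[folklore] -/
theorem setLIntegral_cell_comp_add_of_periodic {L : ℝ} (hL : 0 < L) {H : Space → ℝ≥0∞}
    (hH : Measurable H) (hper : ∀ (x : Space) (k : Fin 3), H (x + EuclideanSpace.single k L) = H x)
    (a : Space) : ∫⁻ x in cell L, H (x + a) = ∫⁻ x in cell L, H x := by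
  have hL3 : (ENNReal.ofReal L ^ 3)⁻¹ ≠ 0 :=
    ENNReal.inv_ne_zero.2 (ENNReal.pow_ne_top ENNReal.ofReal_ne_top)
  have hL3' : (ENNReal.ofReal L ^ 3)⁻¹ ≠ ⊤ :=
    ENNReal.inv_ne_top.2 (pow_ne_zero _ (by simpa using hL))
  have h1 := lintegral_fromUnitTorus hL (G := fun x => H (x + a)) (hH.comp (measurable_id.add_const a))
  have h2 := lintegral_fromUnitTorus hL hH
  have h3 : ∫⁻ t, H (fromUnitTorus L t + a) = ∫⁻ t, H (fromUnitTorus L t) := by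
    have h4 : ∀ t, H (fromUnitTorus L t + a) = H (fromUnitTorus L (t + toUnitTorus L a)) := by
      intro t
      obtain ⟨m, hm⟩ := exists_fromUnitTorus_add_toUnitTorus hL t a
      rw [hm, periodic_latticeVec hper]
    simp_rw [h4]
    exact lintegral_add_right_eq_self (fun t => H (fromUnitTorus L t)) (toUnitTorus L a)
  rw [h3, h2] at h1
  exact ((ENNReal.mul_right_inj hL3 hL3').1 h1).symm

/-- **Shift invariance of cell integrals of periodic functions** (Bochner version). [folklore] -/
theorem setIntegral_cell_comp_add_of_periodic {L : ℝ} (hL : 0 < L) {E : Type*}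
    [NormedAddCommGroup E] [NormedSpace ℝ E] {H : Space → E}
    (hper : ∀ (x : Space) (k : Fin 3), H (x + EuclideanSpace.single k L) = H x)
    (a : Space) : ∫ x in cell L, H (x + a) = ∫ x in cell L, H x := by
  have hL3 : ((L ^ 3)⁻¹ : ℝ) ≠ 0 := inv_ne_zero (pow_ne_zero _ hL.ne')
  have h1 := integral_fromUnitTorus hL (fun x => H (x + a))
  have h2 := integral_fromUnitTorus hL H
  have h3 : ∫ t, H (fromUnitTorus L t + a) = ∫ t, H (fromUnitTorus L t) := by
    have h4 : ∀ t, H (fromUnitTorus L t + a) = H (fromUnitTorus L (t + toUnitTorus L a)) := by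
      intro t
      obtain ⟨m, hm⟩ := exists_fromUnitTorus_add_toUnitTorus hL t a
      rw [hm, periodic_latticeVec hper]
    simp_rw [h4]
    exact integral_add_right_eq_self (fun t => H (fromUnitTorus L t)) (toUnitTorus L a)
  rw [h3, h2] at h1
  exact (smul_right_injective _ hL3 h1).symm

/-! ### Torus coordinates near zero -/

/-- **Torus coordinates near zero**: if every coordinate of `x/L mod ℤ³` has quotient norm `< η`,
then `x` lies within `ηL` of a lattice point in every coordinate. [folklore] -/
theorem exists_latticeVec_near {L : ℝ} (hL : 0 < L) {η : ℝ} {x : Space}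
    (h : ∀ i, ‖toUnitTorus L x i‖ < η) :
    ∃ m : Fin 3 → ℤ, ∀ i, |(x - latticeVec L m) i| < η * L := by
  refine ⟨fun i => round (x i / L), fun i => ?_⟩
  have hi := h i
  simp only [toUnitTorus] at hi
  rw [UnitAddCircle.norm_eq] at hi
  rw [PiLp.sub_apply, latticeVec, PiLp.toLp_apply]
  have : x i - L * (round (x i / L) : ℝ) = L * (x i / L - round (x i / L)) := by
    field_simp
  rw [this, abs_mul, abs_of_pos hL, mul_comm]
  exact mul_lt_mul_of_pos_right hi hL

/-- Squared Euclidean norm from coordinate bounds: `|yᵢ| < b ⇒ ‖y‖² < 3b²`. [folklore] -/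
theorem norm_sq_lt_of_coord {y : Space} {b : ℝ} (h : ∀ i, |y i| < b) :
    ‖y‖ ^ 2 < 3 * b ^ 2 := by
  rw [EuclideanSpace.norm_sq_eq]
  calc ∑ i, ‖y i‖ ^ 2 < ∑ _i : Fin 3, b ^ 2 := by
        refine Finset.sum_lt_sum_of_nonempty Finset.univ_nonempty fun i _ => ?_
        rw [Real.norm_eq_abs]
        exact pow_lt_pow_left₀ (h i) (abs_nonneg _) two_ne_zero
    _ = 3 * b ^ 2 := by simp

/-- **Lattice periodicity transports a local bound around the torus**: if `g(y) ≥ 1 - τ‖y‖²` for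
all `y ∈ ℝ³` and `g` is `Lℤ³`-periodic along the axes, then `g(x) ≥ 1 - 3τ(ηL)²` at every point
`x` whose torus coordinates have quotient norm `< η`. [folklore] -/
theorem periodic_lower_bound_near_lattice {L : ℝ} (hL : 0 < L) {g : Space → ℝ} {τ η : ℝ}
    (hτ : 0 ≤ τ) (hper : ∀ (y : Space) (k : Fin 3), g (y + EuclideanSpace.single k L) = g y)
    (hlow : ∀ y : Space, 1 - τ * ‖y‖ ^ 2 ≤ g y) {x : Space}
    (hx : ∀ i, ‖toUnitTorus L x i‖ < η) : 1 - 3 * τ * (η * L) ^ 2 ≤ g x := by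
  obtain ⟨m, hm⟩ := exists_latticeVec_near hL hx
  have hsq := norm_sq_lt_of_coord hm
  have hgx : g (x - latticeVec L m) = g x := by
    have := periodic_latticeVec hper (x - latticeVec L m) m
    rw [sub_add_cancel] at this
    exact this.symm
  rw [← hgx]
  refine le_trans ?_ (hlow _)
  nlinarith [mul_le_mul_of_nonneg_left hsq.le hτ]

/-! ### The condensate occupation of a real non-negative state through its coherence -/

section Condensate

variable {n : ℕ} {L : ℝ}

/-- `(u + e, Y) = (u, Y) + e_0 ⊗ e`. [folklore] -/
theorem vecCons_add_left (u e : Space) (Y : Config n) :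
    (Matrix.vecCons (u + e) Y : Config (n + 1)) = Matrix.vecCons u Y + Pi.single 0 e := by
  funext j
  refine Fin.cases ?_ (fun k => ?_) j
  · simp
  · simp

/-- Periodicity of a trial state in the tagged coordinate along an axis. [folklore] -/
theorem PeriodicTrialState.vecCons_add_axis_left (Ψ : PeriodicTrialState (n + 1) L) (u : Space)
    (Y : Config n) (k : Fin 3) :
    Ψ.ψ (Matrix.vecCons (u + EuclideanSpace.single k L) Y) = Ψ.ψ (Matrix.vecCons u Y) := by
  rw [vecCons_add_left, Ψ.periodic]

/-- For a real non-negative state the modulus of the slice mean is the integral of the modulus: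
`‖∫_cell Ψ(x,Y) dx‖ = ∫_cell |Ψ(x,Y)| dx` (as an `ℝ≥0∞` identity). [folklore] -/
theorem enorm_integral_slice_eq (Ψ : PeriodicTrialState (n + 1) L)
    (hreal : ∀ X, Ψ.ψ X = (‖Ψ.ψ X‖ : ℂ)) (Y : Config n) :
    (‖∫ x in cell L, Ψ.ψ (Matrix.vecCons x Y)‖₊ : ℝ≥0∞) =
      ∫⁻ x in cell L, (‖Ψ.ψ (Matrix.vecCons x Y)‖₊ : ℝ≥0∞) := by
  have hc : Continuous fun x : Space => ‖Ψ.ψ (Matrix.vecCons x Y)‖ :=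
    (Ψ.contDiff.continuous.comp (continuous_id.matrixVecCons continuous_const)).norm
  have h1 : ∫ x in cell L, Ψ.ψ (Matrix.vecCons x Y) =
      ((∫ x in cell L, ‖Ψ.ψ (Matrix.vecCons x Y)‖ : ℝ) : ℂ) := by
    rw [← integral_complex_ofReal]
    exact integral_congr_ae (Eventually.of_forall fun x => hreal _)
  have hnn : 0 ≤ ∫ x in cell L, ‖Ψ.ψ (Matrix.vecCons x Y)‖ := integral_nonneg fun x => norm_nonneg _
  rw [h1, ← enorm_eq_nnnorm, ← ofReal_norm, Complex.norm_real, Real.norm_of_nonneg hnn,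
    ofReal_integral_eq_lintegral_ofReal (integrableOn_cell hc)
      (Eventually.of_forall fun x => norm_nonneg _)]
  refine lintegral_congr fun x => ?_
  rw [ofReal_norm, enorm_eq_nnnorm]

/-- **The condensate occupation of a positive state through its coherence** (step (i) of the
infrared chain): for a real non-negative periodic state of `n+1` bosons on the torus of side `L`,
`⟨Ψ, n₀Ψ⟩ = (n+1) L⁻³ ∫_cell dr ∫_cell dx ∫_{cell^n} dY |Ψ(x+r,Y)| |Ψ(x,Y)|`
(`|∫_cell Ψ(x,Y)dx|² = ∫∫ Ψ(x,Y)Ψ(x',Y) dx dx'`, Tonelli, and the substitution `x' = x + r` on the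
torus, `setLIntegral_cell_comp_add_of_periodic`). [cite: LSSY2005, §1.2 (1.17); Fournais2020, (1.3)–(1.5)] -/
theorem condensateOccupation_eq_lintegral_coherence (hL : 0 < L) (Ψ : PeriodicTrialState (n + 1) L)
    (hreal : ∀ X, Ψ.ψ X = (‖Ψ.ψ X‖ : ℂ)) :
    condensateOccupation (n + 1) L Ψ.ψ = (n + 1 : ℝ≥0∞) * ((ENNReal.ofReal L ^ 3)⁻¹ *
      ∫⁻ r in cell L, ∫⁻ x in cell L, ∫⁻ Y in cellN n L,
        ENNReal.ofReal (‖Ψ.ψ (Matrix.vecCons (x + r) Y)‖ * ‖Ψ.ψ (Matrix.vecCons x Y)‖)) := by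
  rw [condensateOccupation_succ hL]
  congr 2
  set q : Space → Config n → ℝ≥0∞ := fun u Y => (‖Ψ.ψ (Matrix.vecCons u Y)‖₊ : ℝ≥0∞) with hqdef
  have hqc : Continuous fun p : Space × Config n => q p.1 p.2 := by
    have hc := Ψ.contDiff.continuous
    exact ENNReal.continuous_coe.comp
      ((hc.comp (continuous_fst.matrixVecCons continuous_snd)).nnnorm)
  have hqY : ∀ Y, Measurable fun u => q u Y := fun Y =>
    (hqc.comp (Continuous.prodMk continuous_id continuous_const)).measurable
  have hqper : ∀ (Y : Config n) (u : Space) (k : Fin 3),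
      q (u + EuclideanSpace.single k L) Y = q u Y := by
    intro Y u k
    simp only [hqdef, Ψ.vecCons_add_axis_left]
  -- left-hand side
  have hL1 : ∀ Y, (‖∫ x in cell L, Ψ.ψ (Matrix.vecCons x Y)‖₊ : ℝ≥0∞) ^ 2 =
      (∫⁻ x in cell L, q x Y) ^ 2 := fun Y => by rw [enorm_integral_slice_eq Ψ hreal Y]
  simp_rw [hL1]
  -- right-hand side integrand
  have hR1 : ∀ (r x : Space) (Y : Config n),
      ENNReal.ofReal (‖Ψ.ψ (Matrix.vecCons (x + r) Y)‖ * ‖Ψ.ψ (Matrix.vecCons x Y)‖) =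
        q (x + r) Y * q x Y := by
    intro r x Y
    rw [ENNReal.ofReal_mul (norm_nonneg _), ofReal_norm, ofReal_norm, enorm_eq_nnnorm, enorm_eq_nnnorm]
  simp_rw [hR1]
  -- the kernel `((r, x), Y) ↦ q (x + r) Y * q x Y` is measurable
  have hK : Measurable fun z : (Space × Space) × Config n => q (z.1.2 + z.1.1) z.2 * q z.1.2 z.2 := by
    have h1 : Measurable fun z : (Space × Space) × Config n => q (z.1.2 + z.1.1) z.2 :=
      (hqc.comp (by fun_prop : Continuous fun z : (Space × Space) × Config n =>
        (z.1.2 + z.1.1, z.2))).measurable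
    have h2 : Measurable fun z : (Space × Space) × Config n => q z.1.2 z.2 :=
      (hqc.comp (by fun_prop : Continuous fun z : (Space × Space) × Config n =>
        (z.1.2, z.2))).measurable
    exact h1.mul h2
  have hmeas1 : Measurable (Function.uncurry fun (r x : Space) =>
      ∫⁻ Y in cellN n L, q (x + r) Y * q x Y) :=
    hK.lintegral_prod_right' (ν := volume.restrict (cellN n L))
  rw [lintegral_lintegral_swap hmeas1.aemeasurable]
  have hswap2 : ∀ x : Space, ∫⁻ r in cell L, ∫⁻ Y in cellN n L, q (x + r) Y * q x Y =
      ∫⁻ Y in cellN n L, ∫⁻ r in cell L, q (x + r) Y * q x Y := by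
    intro x
    refine lintegral_lintegral_swap ?_
    exact (hK.comp (by fun_prop : Measurable fun z : Space × Config n => ((z.1, x), z.2))).aemeasurable
  simp_rw [hswap2]
  -- the shift of the fundamental cell in the inner integral
  have hshift : ∀ (x : Space) (Y : Config n),
      ∫⁻ r in cell L, q (x + r) Y * q x Y = (∫⁻ u in cell L, q u Y) * q x Y := by
    intro x Y
    have hm : Measurable fun r : Space => q (x + r) Y :=
      (hqY Y).comp (measurable_const.add measurable_id)
    rw [lintegral_mul_const _ hm]
    congr 1
    simp_rw [add_comm x]
    exact setLIntegral_cell_comp_add_of_periodic hL (hqY Y) (hqper Y) x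
  simp_rw [hshift]
  -- swap back and evaluate
  have hI : Measurable fun Y : Config n => ∫⁻ u in cell L, q u Y := by
    refine Measurable.lintegral_prod_right' (f := fun z : Config n × Space => q z.2 z.1) ?_
    exact (hqc.comp (by fun_prop : Continuous fun z : Config n × Space => (z.2, z.1))).measurable
  have hmeas3 : Measurable (Function.uncurry fun (x : Space) (Y : Config n) =>
      (∫⁻ u in cell L, q u Y) * q x Y) :=
    (hI.comp measurable_snd).mul hqc.measurable
  rw [lintegral_lintegral_swap hmeas3.aemeasurable]
  refine lintegral_congr fun Y => ?_
  rw [lintegral_const_mul _ (hqY Y), sq]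

end Condensate

end Literature.MathematicalPhysics.QuantumManyBody.BoseGas

end
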